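import Mathlib
import Summits.BirchSwinnertonDyer.BirchSwinnertonDyer.Theorems.ResidualThetaTransportAtTwoSignedMuSeedAtTwoPlusNonsquareDescentTowerNorms
import Summits.BirchSwinnertonDyer.BirchSwinnertonDyer.Theorems.ResidualThetaTransportAtTwoSignedMuSeedAtTwoPlusNonsquareDescentCharTwoTower
import Summits.BirchSwinnertonDyer.BirchSwinnertonDyer.Theorems.ResidualThetaTransportAtTwoSignedMuSeedAtTwoPlusNonsquareDescentIndexParity
import HarnessLib

/-!
# Non-square descent — IWASAWA GROWTH, THE `μ ≥ 1` SIDE: A `k⟦X⟧`-LINE QUOTIENT FORCES `#k^{pⁿ} ∣ #(M/ω_nM)` (EXPONENTIAL GROWTH) — completing the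
# module-level dichotomy «`μ = 0` ⟺ sub-exponential growth» for stub S2/S3 of the line card `nonsquare-descent`, seed crux `SignedMuSeedAtTwoPlus`
# stmt-BirchSwinnertonDyer-21438 (parent Kμ⁺ `SignedMuVanishingAtTwoPlus` stmt-BirchSwinnertonDyer-20689, route ResidualThetaTransportAtTwo)

Cell `bsd-wall`, width seat `bsd-wall-rtt-p4-w2` g18 (`--supports`, closes nothing).  THEOREMS ONLY; BSD is not proved by this and
nothing arithmetic is asserted: module algebra.

Complement to the linear-growth theorem at `μ = 0` (`Theorems/…GrowthLinear.lean`): the OTHER branch of the S3 dichotomy («`¬∃ m GNS(m)` ⟹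
`u_∞ ∈ 2Ē^χ` ⟹ `μ ≥ 1`», the card's «`μ_{ℤ₂}(X^χ) ≥ 2`» reading and g17's finite-level `#B'_n ≥ 4^{2ⁿ}`) at the module level and in the limit:
if `M` (over `R`, reduction `φ : R → k⟦X⟧` with `φ T = X`, `k` of characteristic `p`) SURJECTS `R`-linearly onto a module `W ≃ k⟦X⟧` with compatible
structures, then `M/ω_nM ↠ W/ω_nW ≅ k⟦X⟧/(X^{pⁿ})` (`ω_n ≡ T^{pⁿ} mod p`, `…TowerNorms`), so `#k^{pⁿ} ∣ #(M/ω_nM)`: the exponent grows at least like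
`pⁿ·log #k` — EXPONENTIALLY, i.e. `μ ≥ 1`.  Together with lane 2: for `M/pM` f.g. over the PID `k⟦X⟧` EITHER torsion (linear growth) OR with a free
quotient (exponential growth).

* §1 `natCard_powerSeries_quotient_X_pow` — `#(k⟦X⟧/(X^N)) = #k^N` (first `N` coefficients).
* §2 `natCard_line_quotient_omega` — `#(W/((1+X)^{pⁿ}−1)W) = #k^{pⁿ}` for `W ≃ k⟦X⟧`, `char k = p`.
* §3 `natCard_quotient_dvd_of_surjective`, **`pow_dvd_natCard_quotient_omega_of_surjective`** (+ `…_span_omega_…`) — `M ↠ W` (compatible with `φ`, `φT = X`)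
  ⟹ `#k^{pⁿ} ∣ #(M/ω_nM)` for every `n` (`Nat.card`; trivial when infinite).

[folklore]
-/

set_option autoImplicit false
-- the Theorems namespace of this sub repeats the summit name by design (D-0017 nested layout)
set_option linter.dupNamespace false

open scoped Pointwise

namespace Summit.BirchSwinnertonDyer.BirchSwinnertonDyer.Theorems.SignedMuAtTwo.NonsquareDescent

/-! ## §1 `#(k⟦X⟧/(X^N)) = #k^N` -/

section Truncation

variable {k : Type*} [CommRing k]

/-- **`k⟦X⟧ ⧸ (X^N) ≃ (Fin N → k)`** as sets (first `N` coefficients), hence `#(k⟦X⟧/(X^N)) = #k^N`. [folklore] -/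
theorem natCard_powerSeries_quotient_X_pow [Finite k] (N : ℕ) :
    Nat.card (PowerSeries k ⧸ Ideal.span {(PowerSeries.X : PowerSeries k) ^ N}) = Nat.card k ^ N := by
  classical
  have hsec := Ideal.Quotient.mk_surjective (I := Ideal.span {(PowerSeries.X : PowerSeries k) ^ N})
  choose sec hsec using hsec
  let f : (PowerSeries k ⧸ Ideal.span {(PowerSeries.X : PowerSeries k) ^ N}) → (Fin N → k) :=
    fun x i => PowerSeries.coeff (i : ℕ) (sec x)
  have hf : Function.Bijective f := by
    refine ⟨fun x y hxy => ?_, fun v => ?_⟩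
    · rw [← hsec x, ← hsec y, Ideal.Quotient.eq, Ideal.mem_span_singleton, PowerSeries.X_pow_dvd_iff]
      intro m hm
      have h1 := congrFun hxy ⟨m, hm⟩
      simp only [f] at h1
      rw [map_sub, h1, sub_self]
    · refine ⟨Ideal.Quotient.mk _ (PowerSeries.mk fun i => if h : i < N then v ⟨i, h⟩ else 0), funext fun i => ?_⟩
      simp only [f]
      -- `sec (mk g) - g ∈ (X^N)`, so the low coefficients agree
      have h1 : sec (Ideal.Quotient.mk _ (PowerSeries.mk fun i => if h : i < N then v ⟨i, h⟩ else 0)) -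
          (PowerSeries.mk fun i => if h : i < N then v ⟨i, h⟩ else 0) ∈
            Ideal.span {(PowerSeries.X : PowerSeries k) ^ N} := by
        rw [← Ideal.Quotient.eq, hsec]
      rw [Ideal.mem_span_singleton, PowerSeries.X_pow_dvd_iff] at h1
      have h2 := h1 i i.2
      rw [map_sub, sub_eq_zero, PowerSeries.coeff_mk] at h2
      rw [h2, dif_pos i.2]
  rw [Nat.card_congr (Equiv.ofBijective f hf), Nat.card_fun, Nat.card_eq_fintype_card (α := Fin N), Fintype.card_fin]

end Truncation

/-! ## §2 `#(W/ω_nW) = #k^{pⁿ}` for a `k⟦X⟧`-line `W` -/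

section Line

variable {k : Type*} [Field k] (p : ℕ) [Fact p.Prime] [CharP k p]
  {W : Type*} [AddCommGroup W] [Module (PowerSeries k) W]

/-- For `W ≃ k⟦X⟧` over `k⟦X⟧` with `char k = p`: `#(W / ((1+X)^{pⁿ} − 1)•W) = #k^{pⁿ}` (`(1+X)^{pⁿ} − 1 = X^{pⁿ}` in characteristic `p`,
`…TowerNorms`; `#(k⟦X⟧/(X^N)) = #k^N`). [folklore] -/
theorem natCard_line_quotient_omega [Finite k] (e : W ≃ₗ[PowerSeries k] PowerSeries k) (n : ℕ) :
    Nat.card (W ⧸ (((1 + PowerSeries.X : PowerSeries k)) ^ (p ^ n) - 1) • (⊤ : Submodule (PowerSeries k) W)) =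
      Nat.card k ^ (p ^ n) := by
  haveI := charP_powerSeries k p
  rw [one_add_pow_prime_pow_sub_one_of_charP p (PowerSeries.X : PowerSeries k) n]
  have hmap : ((PowerSeries.X : PowerSeries k) ^ (p ^ n) • (⊤ : Submodule (PowerSeries k) W)).map
      (e : W →ₗ[PowerSeries k] PowerSeries k) =
      (PowerSeries.X : PowerSeries k) ^ (p ^ n) • (⊤ : Submodule (PowerSeries k) (PowerSeries k)) := by
    rw [Submodule.map_pointwise_smul, Submodule.map_top, LinearEquiv.range]
  rw [Nat.card_congr (Submodule.Quotient.equiv _ _ e hmap).toEquiv, smul_top_self_eq_span,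
    natCard_powerSeries_quotient_X_pow]

end Line

/-! ## §3 Transport: `M ↠ W` ⟹ `#k^{pⁿ} ∣ #(M/ω_nM)` -/

section Transport

variable {R : Type*} [CommRing R] {M : Type*} [AddCommGroup M] [Module R M]
  {S : Type*} [CommRing S] {W : Type*} [AddCommGroup W] [Module R W] [Module S W]

/-- A surjection `ψ : M ↠ W` compatible with `φ : R → S` induces `M/ωM ↠ W/φ(ω)W`; hence `#(W/φ(ω)W) ∣ #(M/ωM)` (`Nat.card`). [folklore] -/
theorem natCard_quotient_dvd_of_surjective (φ : R →+* S) (hcompat : ∀ (r : R) (w : W), r • w = φ r • w)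
    (ψ : M →ₗ[R] W) (hψ : Function.Surjective ψ) (ω : R) :
    Nat.card (W ⧸ (φ ω • (⊤ : Submodule S W))) ∣ Nat.card (M ⧸ (ω • (⊤ : Submodule R M))) := by
  -- the additive map `M → W/φ(ω)W` kills `ωM`
  let g : M →+ W ⧸ (φ ω • (⊤ : Submodule S W)) :=
    ((φ ω • (⊤ : Submodule S W)).mkQ.toAddMonoidHom).comp ψ.toAddMonoidHom
  have hg : (ω • (⊤ : Submodule R M)).toAddSubgroup ≤ g.ker := by
    intro x hx
    rw [Submodule.mem_toAddSubgroup, Submodule.mem_smul_pointwise_iff_exists] at hx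
    obtain ⟨y, -, rfl⟩ := hx
    rw [AddMonoidHom.mem_ker]
    change (φ ω • (⊤ : Submodule S W)).mkQ (ψ (ω • y)) = 0
    rw [map_smul, hcompat, Submodule.mkQ_apply, Submodule.Quotient.mk_eq_zero]
    exact Submodule.smul_mem_pointwise_smul _ _ ⊤ Submodule.mem_top
  have hsurj : Function.Surjective (QuotientAddGroup.lift _ g hg) := by
    intro q
    obtain ⟨w, rfl⟩ := Submodule.mkQ_surjective _ q
    obtain ⟨m, rfl⟩ := hψ w
    exact ⟨QuotientAddGroup.mk m, rfl⟩
  exact AddSubgroup.card_dvd_of_surjective _ hsurj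

variable {k : Type*} [Field k] [Finite k] (p : ℕ) [Fact p.Prime] [CharP k p]

/-- **`μ ≥ 1` FORCES EXPONENTIAL GROWTH.**  `φ : R →+* k⟦X⟧` with `φ T = X` (`char k = p`), `ψ : M ↠ W` an `R`-linear surjection onto a module
`W ≃ k⟦X⟧` with compatible structures (`r • w = φ r • w`): then `#k^{pⁿ} ∣ #(M/ω_nM)` for every `n`, `ω_n = (1+T)^{pⁿ} − 1` — the exponent of
`#(M/ω_nM)` is `≥ pⁿ·log #k` whenever finite («`u_∞ ∈ 2Ē^χ` ⟹ `Q' ↠ 𝔽₄⟦T⟧` ⟹ `μ ≥ 1`», the limit form of g17's `#B'_n ≥ 4^{2ⁿ}`). [folklore] -/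
theorem pow_dvd_natCard_quotient_omega_of_surjective
    {W' : Type*} [AddCommGroup W'] [Module R W'] [Module (PowerSeries k) W']
    (φ : R →+* PowerSeries k) (hcompat : ∀ (r : R) (w : W'), r • w = φ r • w) {T : R} (hTX : φ T = PowerSeries.X)
    (e : W' ≃ₗ[PowerSeries k] PowerSeries k) (ψ : M →ₗ[R] W') (hψ : Function.Surjective ψ) (n : ℕ) :
    Nat.card k ^ (p ^ n) ∣ Nat.card (M ⧸ (((1 + T) ^ (p ^ n) - 1) • (⊤ : Submodule R M))) := by
  have h1 := natCard_quotient_dvd_of_surjective φ hcompat ψ hψ ((1 + T) ^ (p ^ n) - 1)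
  rw [map_sub, map_pow, map_add, map_one, hTX, natCard_line_quotient_omega p e n] at h1
  exact h1

/-- The same with the ideal-`smul` spelling `Ideal.span {ω_n} • ⊤` used by the growth files. [folklore] -/
theorem pow_dvd_natCard_quotient_span_omega_of_surjective
    {W' : Type*} [AddCommGroup W'] [Module R W'] [Module (PowerSeries k) W']
    (φ : R →+* PowerSeries k) (hcompat : ∀ (r : R) (w : W'), r • w = φ r • w) {T : R} (hTX : φ T = PowerSeries.X)
    (e : W' ≃ₗ[PowerSeries k] PowerSeries k) (ψ : M →ₗ[R] W') (hψ : Function.Surjective ψ) (n : ℕ) :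
    Nat.card k ^ (p ^ n) ∣ Nat.card (M ⧸ Ideal.span {(1 + T) ^ (p ^ n) - 1} • (⊤ : Submodule R M)) := by
  rw [Submodule.ideal_span_singleton_smul]
  exact pow_dvd_natCard_quotient_omega_of_surjective p φ hcompat hTX e ψ hψ n

end Transport

end Summit.BirchSwinnertonDyer.BirchSwinnertonDyer.Theorems.SignedMuAtTwo.NonsquareDescent
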